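import Summits.RiemannHypothesis.RiemannHypothesis.Theorems.SuzukiStructureFunctionsEntire
import Summits.RiemannHypothesis.RiemannHypothesis.Theorems.SuzukiStructureFunctionsXiStrip
import Summits.RiemannHypothesis.RiemannHypothesis.Theorems.SuzukiPhiZetaKernels
import Literature.NumberTheory.LFunctions.SuzukiCanonicalSystemKernelProofs

/-!
# SuzukiStructureFunctionsZetaPair — `(ϱ_ζ^{ω,ν}, K_ζ^{ω,ν})` IS a Suzuki pair (JFA21 Lemma 4.1 + (K2) in the
# time domain), so the structure-function corpus applies to `ζ`: `E_ζ^{ω,ν}(t,·)` is entire for every `t ≥ 0`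
# (column DBR; RH-FREE)

LINE 1 — LABEL: RH-FREE (absolutely convergent line integrals in the half-planes of absolute convergence, Schwarz
reflection, `ξ(1−s) = ξ(s)`, Fubini; no zeros, no positivity); bears_on LADDER-RH B-D → B-P(P1)/(P3): Suzuki's
Thm. 2.2 structure function `E_ζ^{ω,ν}(t,z) = A_ζ^{ω,ν}(t,z) − iB_ζ^{ω,ν}(t,z)` now exists in the kernel as an entire
function with `E♯ = E(−·)` symmetry for EVERY `t ≥ 0` when `ω ≥ ½`, `ν ≥ 1`, `νω > 1` (UNCONDITIONAL: the windows are
solvable by `exists_isSuzukiPhiSolution_suzukiKernel`). WHAT THIS IS NOT: not progress toward RH; `E_ζ^{ω,ν}(t,·) ∈ HB̄`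
/ `lim J(t;z,z) = 0` (Thm. 2.4, GRH-equivalent as `ω → 0`) is NOT claimed; the canonical system (Thm. 3.1 (4)) is the
declared residual; nothing here bears on the truth of RH.

Source: M. Suzuki, J. Funct. Anal. 281 (2021) 109116 = arXiv:1606.05726 [Suzuki2021Hamiltonians], Lemma 4.1,
Prop. 4.1, Thm. 2.2 (2.12).

Contents (seat rh-dbr-eng-5 g7; continuation of `…XiStrip` and `…Entire`):
* `conj_suzukiE_line`, `conj_invFourierLine_suzukiE`, `ofReal_suzukiRho` — reality of (4.1) on every line;
* `continuous_suzukiRho`, `abs_suzukiRho_le` — Lemma 4.1: `ϱ_ζ^{ω,ν}` continuous with `|ϱ| ≪_n e^{−n|x|}`;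
* `suzukiE_mul_suzukiTheta` (`EΘ = E(−·)`), **`suzukiRho_conv_suzukiKernel`** — (K2) in the time domain,
  `∫ ϱ(x−y)K(y) dy = ϱ(−x)` (Fubini + the tree's Laplace formula (4.9) `suzuki2021_prop41_fourier`);
* **`isSuzukiPair_zeta`** — `IsSuzukiPair (suzukiRho ω ν) (suzukiKernel ω ν)` for `ω > 0`, `ν ≥ 1`, `νω > 1`;
* **`differentiable_suzukiEt`** (`E_ζ^{ω,ν}(t,·)` entire, all `t ≥ 0`, `ω ≥ ½`), `sharp_suzukiEt`
  (`E(t,·)♯ = E(t,−·)`), `suzukiEt_zero` (`E(0,·) = 𝖥ϱ_ζ^{ω,ν}`; the inversion `𝖥ϱ = E` is not proved here).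
-/

noncomputable section

-- D-0017: `Summit.<S>.<S>.…` is the designed namespace of a single-problem summit.
set_option linter.dupNamespace false

open MeasureTheory Set Complex Filter Topology
open scoped ComplexConjugate

namespace Summit.RiemannHypothesis.RiemannHypothesis.Theorems.SuzukiStructureFunctions

open Literature.NumberTheory.LFunctions Literature.NumberTheory.LFunctions.SuzukiStructure
open scoped Real

/-! ## §12 Lemma 4.1 for `ζ` and (K2) in the time domain: `IsSuzukiPair (ϱ_ζ^{ω,ν}, K_ζ^{ω,ν})` -/

/-- RH-FREE. `conj E(u+iv) = E(−u+iv)` (Schwarz reflection `ξ(s̄) = conj ξ(s)`; «`(E_L^{ω,ν})♯(z) = E_L^{ω,ν}(−z)`»). -/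
theorem conj_suzukiE_line (ω : ℝ) (ν : ℕ) (u v : ℝ) :
    conj (suzukiE ω ν ((u : ℂ) + (v : ℂ) * I)) = suzukiE ω ν (((-u : ℝ) : ℂ) + (v : ℂ) * I) := by
  have hT : conj ((1 : ℂ) / 2 + (ω : ℂ) - I * ((u : ℂ) + (v : ℂ) * I)) =
      (1 : ℂ) / 2 + (ω : ℂ) - I * (((-u : ℝ) : ℂ) + (v : ℂ) * I) := by
    apply Complex.ext <;> simp
  unfold suzukiE
  rw [map_pow, ← riemannXi_conj_holds, hT]

/-- RH-FREE. The line integrals (4.1) are real: `conj (invFourierLine E v x) = invFourierLine E v x`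
(«by taking `c = 0` in (4.1), we find that `ϱ_L^{ω,ν}` is real-valued»; here on every line). -/
theorem conj_invFourierLine_suzukiE (ω : ℝ) (ν : ℕ) (v x : ℝ) :
    conj (invFourierLine (suzukiE ω ν) v x) = invFourierLine (suzukiE ω ν) v x := by
  unfold invFourierLine
  rw [map_mul]
  congr 1
  · rw [map_div₀, map_one, map_mul, Complex.conj_ofReal, map_ofNat]
  · rw [← integral_conj]
    have hint : ∀ u : ℝ, conj (suzukiE ω ν ((u : ℂ) + (v : ℂ) * I) *
        Complex.exp (-I * ((u : ℂ) + (v : ℂ) * I) * (x : ℂ))) =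
        suzukiE ω ν (((-u : ℝ) : ℂ) + (v : ℂ) * I) *
          Complex.exp (-I * (((-u : ℝ) : ℂ) + (v : ℂ) * I) * (x : ℂ)) := by
      intro u
      rw [map_mul, conj_suzukiE_line, ← Complex.exp_conj]
      congr 2
      simp only [map_mul, map_neg, Complex.conj_I, map_add, Complex.conj_ofReal, neg_neg]
      push_cast
      ring
    simp_rw [hint]
    have h := (integral_neg_eq_self (μ := (volume : Measure ℝ))
      (fun u : ℝ => suzukiE ω ν ((u : ℂ) + (v : ℂ) * I) * Complex.exp (-I * ((u : ℂ) + (v : ℂ) * I) * (x : ℂ))))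
    simpa using h

/-- RH-FREE. `(ϱ_ζ^{ω,ν}(x) : ℂ) = invFourierLine E_ζ^{ω,ν} 0 x` (the real part in the definition of `suzukiRho`
is the whole integral). -/
theorem ofReal_suzukiRho (ω : ℝ) (ν : ℕ) (x : ℝ) :
    (suzukiRho ω ν x : ℂ) = invFourierLine (suzukiE ω ν) 0 x := by
  have him : (invFourierLine (suzukiE ω ν) 0 x).im = 0 := by
    have h := congrArg Complex.im (conj_invFourierLine_suzukiE ω ν 0 x)
    simp only [Complex.conj_im] at h
    linarith
  apply Complex.ext
  · simp [suzukiRho]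
  · simpa [suzukiRho] using him.symm

/-- RH-FREE. **Lemma 4.1 (regularity): `ϱ_ζ^{ω,ν}` is continuous** (`ν ≥ 1`). -/
theorem continuous_suzukiRho (ω : ℝ) {ν : ℕ} (hν : 1 ≤ ν) : Continuous (suzukiRho ω ν) := by
  have h : Continuous fun x : ℝ => invFourierLine (suzukiE ω ν) 0 x :=
    continuous_invFourierLine le_rfl (fun x => by
      simpa using integrable_suzukiE_lineIntegrand ω hν 0 x)
  have e : suzukiRho ω ν = fun x => (invFourierLine (suzukiE ω ν) 0 x).re := by funext x; rfl
  rw [e]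
  exact Complex.continuous_re.comp h

/-- RH-FREE. **Lemma 4.1 (decay): `|ϱ_ζ^{ω,ν}(x)| ≪_n e^{−n|x|}` for every `n`** («by moving the path of
integration in (4.1) to the upside or downside»). -/
theorem abs_suzukiRho_le (ω : ℝ) {ν : ℕ} (hν : 1 ≤ ν) (n : ℝ) :
    ∃ C : ℝ, ∀ x : ℝ, |suzukiRho ω ν x| ≤ C * Real.exp (-(n * |x|)) := by
  set Ip : ℝ := ∫ u : ℝ, ‖suzukiE ω ν ((u : ℂ) + (n : ℂ) * I)‖ with hIp
  set Im : ℝ := ∫ u : ℝ, ‖suzukiE ω ν ((u : ℂ) + ((-n : ℝ) : ℂ) * I)‖ with hIm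
  refine ⟨1 / (2 * Real.pi) * max Ip Im, fun x => ?_⟩
  have h0 : |suzukiRho ω ν x| ≤ ‖invFourierLine (suzukiE ω ν) 0 x‖ := by
    rw [suzukiRho_def]; exact Complex.abs_re_le_norm _
  rcases le_or_gt 0 x with hx | hx
  · rw [invFourierLine_suzukiE_eq ω hν 0 (-n) x] at h0
    have h1 := norm_invFourierLine_le (suzukiE ω ν) (-n) x
    rw [abs_of_nonneg hx]
    calc |suzukiRho ω ν x| ≤ 1 / (2 * Real.pi) * Real.exp (-n * x) * Im := h0.trans (by simpa [hIm] using h1)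
      _ ≤ 1 / (2 * Real.pi) * Real.exp (-n * x) * max Ip Im := by gcongr; exact le_max_right _ _
      _ = 1 / (2 * Real.pi) * max Ip Im * Real.exp (-(n * x)) := by ring_nf
  · rw [invFourierLine_suzukiE_eq ω hν 0 n x] at h0
    have h1 := norm_invFourierLine_le (suzukiE ω ν) n x
    rw [abs_of_neg hx]
    calc |suzukiRho ω ν x| ≤ 1 / (2 * Real.pi) * Real.exp (n * x) * Ip := h0.trans h1
      _ ≤ 1 / (2 * Real.pi) * Real.exp (n * x) * max Ip Im := by gcongr; exact le_max_left _ _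
      _ = 1 / (2 * Real.pi) * max Ip Im * Real.exp (-(n * -x)) := by ring_nf

/-- RH-FREE. `E(z)·Θ(z) = E(−z)` wherever `ξ(½+ω−iz) ≠ 0` (`Θ = E♯/E`, `E♯(z) = E(−z)`, `ξ(1−s) = ξ(s)`). -/
theorem suzukiE_mul_suzukiTheta {ω : ℝ} {ν : ℕ} {z : ℂ} (h : riemannXi (1 / 2 + ω - I * z) ≠ 0) :
    suzukiE ω ν z * suzukiTheta ω ν z = suzukiE ω ν (-z) := by
  unfold suzukiE suzukiTheta
  rw [← mul_pow, mul_div_cancel₀ _ h]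
  congr 1
  rw [← riemannXi_one_sub (1 / 2 + ω - I * -z)]
  congr 1
  ring

/-- RH-FREE. **(K2) IN THE TIME DOMAIN for `ζ`: `∫ ϱ_ζ^{ω,ν}(x−y) K_ζ^{ω,ν}(y) dy = ϱ_ζ^{ω,ν}(−x)`** for `ω > 0`,
`ν ≥ 1`, `νω > 1` — i.e. `E·Θ = E♯` read through the inverse transforms: `ϱ` on the line `Im z = 2+ω`,
Fubini, the Laplace formula (4.9) `∫ K(y)e^{izy} dy = Θ(z)` (`suzuki2021_prop41_fourier`), `E(z)Θ(z) = E(−z)`,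
and back to `ϱ(−x)` on the line `Im z = −(2+ω)`. -/
theorem suzukiRho_conv_suzukiKernel {ω : ℝ} (hω : 0 < ω) {ν : ℕ} (hν : 1 ≤ ν) (hνω : 1 < (ν : ℝ) * ω)
    (x : ℝ) : ∫ y : ℝ, suzukiRho ω ν (x - y) * suzukiKernel ω ν y = suzukiRho ω ν (-x) := by
  set c : ℝ := 2 + ω with hc
  have hcω : 1 / 2 + ω < c := by rw [hc]; linarith
  -- growth of `K` on the line `1 + ω` and its vanishing on `(−∞,0)`
  obtain ⟨D, hD0, hKle⟩ := suzuki2021_prop41_v hω ν hνω (v := 1 + ω) (by linarith)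
  have hK0 : ∀ y : ℝ, y < 0 → suzukiKernel ω ν y = 0 := fun y hy => (suzuki2021_prop41_i hω hν hνω hy).1
  have hKc : Continuous (suzukiKernel ω ν) := suzuki2021_prop41_iv hω ν hνω
  set E : ℝ → ℂ := fun u => suzukiE ω ν ((u : ℂ) + (c : ℂ) * I) with hE
  set ex : ℝ → ℂ := fun u => cexp (-I * ((u : ℂ) + (c : ℂ) * I) * (x : ℂ)) with hex
  -- the Fubini integrand
  set f : ℝ → ℝ → ℂ := fun y u => E u * ex u * ((suzukiKernel ω ν y : ℂ) * cexp (I * ((u : ℂ) + (c : ℂ) * I) * y))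
    with hf
  -- Step 1: complexify and insert the line-`c` representation of `ϱ(x − y)`
  have hrep : ∀ y : ℝ, ((suzukiRho ω ν (x - y) * suzukiKernel ω ν y : ℝ) : ℂ) =
      (1 : ℂ) / (2 * (Real.pi : ℂ)) * ∫ u : ℝ, f y u := by
    intro y
    push_cast
    rw [ofReal_suzukiRho, invFourierLine_suzukiE_eq ω hν 0 c (x - y)]
    unfold invFourierLine
    rw [mul_assoc, ← integral_mul_const]
    congr 1
    refine integral_congr_ae (Eventually.of_forall fun u => ?_)
    simp only [hf, hE, hex]
    have hexp : cexp (-I * ((u : ℂ) + (c : ℂ) * I) * ((x - y : ℝ) : ℂ)) =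
        cexp (-I * ((u : ℂ) + (c : ℂ) * I) * (x : ℂ)) * cexp (I * ((u : ℂ) + (c : ℂ) * I) * y) := by
      rw [← Complex.exp_add]; congr 1; push_cast; ring
    rw [hexp]; ring
  -- Step 2: integrability on the product
  have hEi : Integrable fun u : ℝ => ‖E u‖ * Real.exp (c * x) := by
    have h := (integrable_suzukiE_lineIntegrand ω hν c x).norm
    refine h.congr (Eventually.of_forall fun u => ?_)
    simp only [hE, norm_mul, norm_cexp_neg_I_line]
  have hHi : Integrable fun y : ℝ => |suzukiKernel ω ν y| * Real.exp (-(c * y)) := by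
    refine Integrable.mono' ((Literature.Analysis.Complex.integrable_exp_neg_mul_abs one_pos).const_mul D)
      ((hKc.abs.mul (by fun_prop)).aestronglyMeasurable) (Eventually.of_forall fun y => ?_)
    rw [Real.norm_eq_abs, abs_mul, abs_abs, abs_of_pos (Real.exp_pos _)]
    rcases lt_or_ge y 0 with hy | hy
    · rw [hK0 y hy, abs_zero, zero_mul]; positivity
    · calc |suzukiKernel ω ν y| * Real.exp (-(c * y)) ≤ D * Real.exp ((1 + ω) * y) * Real.exp (-(c * y)) :=
            mul_le_mul_of_nonneg_right (hKle y) (Real.exp_pos _).le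
        _ = D * Real.exp (-1 * |y|) := by
            rw [abs_of_nonneg hy, mul_assoc, ← Real.exp_add]; congr 2; rw [hc]; ring
  have hfi : Integrable (Function.uncurry f) ((volume : Measure ℝ).prod volume) := by
    refine Integrable.mono' (hHi.mul_prod hEi) ?_ (Eventually.of_forall fun p => ?_)
    · refine Continuous.aestronglyMeasurable ?_
      simp only [hf, hE, hex, Function.uncurry_def]
      have hEc : Continuous fun u : ℝ => suzukiE ω ν ((u : ℂ) + (c : ℂ) * I) :=
        (differentiable_suzukiE ω ν).continuous.comp (by fun_prop)
      exact ((hEc.comp continuous_snd).mul (by fun_prop)).mul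
        ((Complex.continuous_ofReal.comp (hKc.comp continuous_fst)).mul (by fun_prop))
    · rcases p with ⟨y, u⟩
      simp only [Function.uncurry_apply_pair, hf, norm_mul, Complex.norm_real, Real.norm_eq_abs, hex,
        norm_cexp_neg_I_line]
      have h2 : ‖cexp (I * ((u : ℂ) + (c : ℂ) * I) * (y : ℂ))‖ = Real.exp (-(c * y)) := by
        rw [Complex.norm_exp]; congr 1
        simp only [Complex.mul_re, Complex.mul_im, Complex.add_re, Complex.add_im, Complex.I_re, Complex.I_im,
          Complex.ofReal_re, Complex.ofReal_im]
        ring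
      rw [h2]
      have : ‖E u‖ * Real.exp (c * x) * (|suzukiKernel ω ν y| * Real.exp (-(c * y))) =
          |suzukiKernel ω ν y| * Real.exp (-(c * y)) * (‖E u‖ * Real.exp (c * x)) := by ring
      rw [this]
  -- Step 3: the inner `y`-integrals via (4.9)
  have hinner : ∀ u : ℝ, ∫ y : ℝ, f y u = E u * ex u * suzukiTheta ω ν ((u : ℂ) + (c : ℂ) * I) := by
    intro u
    simp only [hf]
    rw [integral_const_mul]
    congr 1
    exact (suzuki2021_prop41_fourier hω hν hνω (z := (u : ℂ) + (c : ℂ) * I) (by simpa using hcω)).2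
  -- Step 4: `E Θ = E(−·)` on the line
  have hEΘ : ∀ u : ℝ, E u * suzukiTheta ω ν ((u : ℂ) + (c : ℂ) * I) = suzukiE ω ν (-((u : ℂ) + (c : ℂ) * I)) := by
    intro u
    simp only [hE]
    refine suzukiE_mul_suzukiTheta (riemannXi_ne_zero_of_one_le_re ?_)
    simp; rw [hc]; linarith
  -- Step 5: the right-hand side on the line `−c`
  have hrhs : (suzukiRho ω ν (-x) : ℂ) = (1 : ℂ) / (2 * (Real.pi : ℂ)) *
      ∫ u : ℝ, suzukiE ω ν (-((u : ℂ) + (c : ℂ) * I)) * ex u := by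
    rw [ofReal_suzukiRho, invFourierLine_suzukiE_eq ω hν 0 (-c) (-x)]
    unfold invFourierLine
    congr 1
    rw [← integral_neg_eq_self]
    refine integral_congr_ae (Eventually.of_forall fun u => ?_)
    simp only [hex]
    congr 1
    · congr 1; push_cast; ring
    · congr 1; push_cast; ring
  -- assemble
  have hlhs : ((∫ y : ℝ, suzukiRho ω ν (x - y) * suzukiKernel ω ν y : ℝ) : ℂ) =
      ∫ y : ℝ, ((suzukiRho ω ν (x - y) * suzukiKernel ω ν y : ℝ) : ℂ) := integral_ofReal.symm
  apply Complex.ofReal_injective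
  rw [hlhs]
  simp_rw [hrep]
  rw [integral_const_mul, integral_integral_swap hfi]
  simp_rw [hinner]
  rw [hrhs]
  congr 1
  refine integral_congr_ae (Eventually.of_forall fun u => ?_)
  simp only
  rw [mul_right_comm, hEΘ u]

/-- RH-FREE. `K_ζ^{ω,ν}(0) = 0` (continuity and vanishing on `(−∞,0)`). -/
theorem suzukiKernel_zero {ω : ℝ} (hω : 0 < ω) {ν : ℕ} (hν : 1 ≤ ν) (hνω : 1 < (ν : ℝ) * ω) :
    suzukiKernel ω ν 0 = 0 := by
  have hKc : Continuous (suzukiKernel ω ν) := suzuki2021_prop41_iv hω ν hνω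
  have hcl : IsClosed {y : ℝ | suzukiKernel ω ν y = 0} := isClosed_eq hKc continuous_const
  have hsub : Iio (0 : ℝ) ⊆ {y : ℝ | suzukiKernel ω ν y = 0} := fun y hy => (suzuki2021_prop41_i hω hν hνω hy).1
  have h := hcl.closure_subset_iff.2 hsub
  rw [closure_Iio] at h
  exact h (le_refl (0 : ℝ))

/-- **RH-FREE · `(ϱ_ζ^{ω,ν}, K_ζ^{ω,ν})` IS A SUZUKI PAIR for `ω > 0`, `ν ≥ 1`, `νω > 1`** (Lemma 4.1 + Prop. 4.1
(1),(4),(5) + (K2) in the time domain): every theorem of the `SuzukiStructureFunctions*` files applies to the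
`ζ` data — in particular, on every solvable window of `K_ζ^{ω,ν}` (for `ω ≥ ½`: EVERY `t ≥ 0`, by
`exists_isSuzukiPhiSolution_suzukiKernel`), Suzuki's `E_ζ^{ω,ν}(t,·) = A(t,·) − iB(t,·)` is a kernel-checked
real entire function with `E(0,·) = E_ζ^{ω,ν}`. -/
theorem isSuzukiPair_zeta {ω : ℝ} (hω : 0 < ω) {ν : ℕ} (hν : 1 ≤ ν) (hνω : 1 < (ν : ℝ) * ω) :
    IsSuzukiPair (suzukiRho ω ν) (suzukiKernel ω ν) where
  continuous_rho := continuous_suzukiRho ω hν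
  abs_rho_le := abs_suzukiRho_le ω hν
  continuous_kernel := suzuki2021_prop41_iv hω ν hνω
  abs_kernel_le := by
    obtain ⟨D, hD0, hKle⟩ := suzuki2021_prop41_v hω ν hνω (v := 1 + ω) (by linarith)
    refine ⟨1 + ω, D, by linarith, fun x => (hKle x).trans ?_⟩
    exact mul_le_mul_of_nonneg_left (Real.exp_le_exp.2
      (mul_le_mul_of_nonneg_left (le_abs_self x) (by linarith))) hD0
  kernel_eq_zero := by
    intro x hx
    rcases lt_or_eq_of_le hx with h | h
    · exact (suzuki2021_prop41_i hω hν hνω h).1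
    · rw [h]; exact suzukiKernel_zero hω hν hνω
  conv_eq := suzukiRho_conv_suzukiKernel hω hν hνω

/-- RH-FREE. **`E_ζ^{ω,ν}(t,·)` IS ENTIRE for every `t ≥ 0` when `ω ≥ ½`, `ν ≥ 1`, `νω > 1`** (Suzuki Thm. 2.2's
structure function of `ζ`, unconditionally: the windows are solvable by `exists_isSuzukiPhiSolution_suzukiKernel`). -/
theorem differentiable_suzukiEt {ω : ℝ} (hω : 1 / 2 ≤ ω) {ν : ℕ} (hν : 1 ≤ ν) (hνω : 1 < (ν : ℝ) * ω)
    {t : ℝ} (ht : 0 ≤ t) : Differentiable ℂ (suzukiEt ω ν t) := by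
  have hp := SuzukiPhiExistence.exists_isSuzukiPhiSolution_suzukiKernel hω hν hνω ht (ε := 1) (Or.inl rfl)
  have hm := SuzukiPhiExistence.exists_isSuzukiPhiSolution_suzukiKernel hω hν hνω ht (ε := -1) (Or.inr rfl)
  exact differentiable_structE (isSuzukiPair_zeta (by linarith) hν hνω) hp hm

/-- RH-FREE. **`E_ζ^{ω,ν}(0,z) = 𝖥ϱ_ζ^{ω,ν}(z)`** (Thm. 3.1 (5) for `ζ`; `ω > 0`, `ν ≥ 1`, `νω > 1`). That
`𝖥ϱ_ζ^{ω,ν} = E_ζ^{ω,ν}` (the Fourier-inversion half of Lemma 4.1) is NOT proved in this file. -/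
theorem suzukiEt_zero {ω : ℝ} (hω : 0 < ω) {ν : ℕ} (hν : 1 ≤ ν) (hνω : 1 < (ν : ℝ) * ω) (z : ℂ) :
    suzukiEt ω ν 0 z = fourier (suzukiRho ω ν) z :=
  structE_zero (isSuzukiPair_zeta hω hν hνω) z

/-- RH-FREE. **`E_ζ^{ω,ν}(t,·)♯ = E_ζ^{ω,ν}(t,−·)`** for every `t ≥ 0` (`ω ≥ ½`, `ν ≥ 1`, `νω > 1`). -/
theorem sharp_suzukiEt {ω : ℝ} (hω : 1 / 2 ≤ ω) {ν : ℕ} (hν : 1 ≤ ν) (hνω : 1 < (ν : ℝ) * ω)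
    {t : ℝ} (ht : 0 ≤ t) (z : ℂ) :
    Literature.Analysis.DeBrangesSpaces.sharp (suzukiEt ω ν t) z = suzukiEt ω ν t (-z) := by
  have hp := SuzukiPhiExistence.exists_isSuzukiPhiSolution_suzukiKernel hω hν hνω ht (ε := 1) (Or.inl rfl)
  have hm := SuzukiPhiExistence.exists_isSuzukiPhiSolution_suzukiKernel hω hν hνω ht (ε := -1) (Or.inr rfl)
  exact sharp_structE (isSuzukiPair_zeta (by linarith) hν hνω) hp hm z

end Summit.RiemannHypothesis.RiemannHypothesis.Theorems.SuzukiStructureFunctions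

end
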